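/-
Copyright (c) 2026 the pub-hodgecm-mathlib formalisation cell (harness21).  Prover seat hodgecm-mathlib-R90-C10-p04 (g3), SLAB R90-TF, section S1 «Ch. 10∕12 local»,
cell «U4-RAM :182 (S-W) wild», card (W-5) (dealer R90-C10-plan (g3) 03:26:29Z; STEP 1 census `R90/R90-C10-p04/g3/CENSUS-W5.v1.md` 3a0c5555e61be0df): THE (S-W) HEAD OF RECORD
MODULO THREE NAMED LETTERS `HWA` ∕ `HWRa` ∕ `HWRb` — the (8⁺b) pattern for the wild socket of U4Keys :182, crux H413 = `stmt-HodgeConjecture-24833`.  KERNEL module: THEOREMS ONLY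
(no definition, no named fact, no `sorry`, no instance, no notation).  2026-09-05.
-/
import Summits.HodgeConjecture.HodgeConjecture.Theorems.R90S1BposRamConversionWild        -- ★ p865037 (W-2′) (this seat): the conversion over `∃ Π, root` (§4), uniformiser-free
import Literature.NumberTheory.Automorphic.UnitaryGroupPrincipalSeriesExponents            -- ★ `cmTorusCharPair`; brings ★ `cmPrincipalSeries` (UnitaryGroupBorelInduction)
import HarnessLib

/-!
# R90-TF S1 «Ch10-local» ∕ K2 E3 «U4Keys» :182 — POSITIVE DEPTH AT A WILDLY RAMIFIED (DYADIC) NON-SPLIT PLACE: THE (S-W) HEAD MODULO THREE NAMED LETTERS (W-5)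
# «`v` non-split, ramified in `L`, `|2|_{w′} ≠ 1` somewhere; `χ₁` continuous, non-unitary, contracting, of positive depth; `i(χ₁,1)` reducible ⟹ `χ₁ = ‖·‖ ∨ χ₁ = η·‖·‖^{1∕2}`»
# modulo `HWA` (Branch-A irreducibility), `HWRa` ((R-a) irreducibility), `HWRb` ((R-b) root)   [Keys1984 §7 Thm (2); Rogawski1990 §12.2 (1)–(2); Shahidi1990 §8; Serre1979 V §3]

Cell `pub/hodgecm-mathlib` (D-0151), crux H413 = `stmt-HodgeConjecture-24833`, route of record `HCCMUnconditional` (no route verbs); R90-TF section S1 (organ `K2_E3_EllipticInputsSigs_U4Keys`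
ED. 11 TREE 34995a1f00e8d08f, socket (S-W) `sig_K2E3KeysThmTwoContractingRamifiedCharOnePosDepthWild` :266–:282).  THEOREMS ONLY; ★-only imports (NO `Lines` import); lane `--supports
stmt-HodgeConjecture-24833 --as helper`, count-neutral.  **NOT THE PAYER of (S-W)**: the head below carries THREE OPEN LETTERS over the head's own binders `L v χ₁`, one per cell of
the S1 partition of the wild corner (R90-C10-p02 (g3) census f6499a1e §4, adopted R-S1-36):
* **`HWA`** — Branch A (`χ₁(u·σu) ≠ 1` for some unit `u` of absolute value one): `i(χ₁, 1)` is IRREDUCIBLE (Keys' list; Road I = Keys' γ-factor ∕ [Shahidi1990 §8], or Road II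
  [Roche2002]; the tame∕inert twins ★ p863367 ∕ ★ p863432 use an integral trace-one element resp. `|2|_w = 1`, both of which fail here — ★ (W-0) `valued_traceMin_eq_one_iff_not_wild`).  XL.
* **`HWRa`** — Branch B (`hB`) and sub-branch (R-a) (`χ₁ = 1` on the `σ`-fixed units of absolute value one): `i(χ₁, 1)` is IRREDUCIBLE (off Keys' list at a ramified place; Road I for
  `cond χ₁ < δ`, the wild determinant road after P-wild-1 for `cond χ₁ ≥ δ` — the producer splits, the letter does not).  XL∕L.
* **`HWRb`** — Branch B, sub-branch (R-b) (`hFε`: a `σ`-fixed unit of absolute value one with `χ₁ ≠ 1`), reducible: THE ROOT `χ₁(σΠ·Π) = ‖σΠ·Π‖^{1∕2}` at SOME uniformiser unit `Π`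
  (★ (W-2′) §3: choice-free; ★ `exists_uniformizer_units`: a `Π` always exists) — the wild shell law (P-wild-1, `ω = normSign` sums) + the wild determinant road deliver it.  L after P-wild-1.
THE COMPOSITION: Branch A and (R-a) close by `absurd hred`; (R-b) gives DISJUNCT 2 of the socket by ★ (W-2′) §4 `exists_eta_of_branchB_of_exists_root_of_fixedUnit` (uniformiser-free
conversion, no `|2|_w = 1`, no tameness).  The case split needs no lemma (`by_cases hB`, `by_cases hRa`); ★-to-be (W-2) `apply_fixed_eq_normSign` is a PRODUCER-side tool.
* §1 **`exists_eta_of_reducible_posDepth_normTrivial_wild`** — socket binders `hns hunr h2 χ₁ h₁ hnu hcontr hram hpos` (:266–:279 VERBATIM, `LocalRing` spelling of ★ (8⁺b); `hunr h2 hnu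
  hcontr hram hpos` carried for the socket's ∀-text, unused), then `HWA HWRa HWRb`, then `hred` ⊢ the socket's conclusion :280–:282 VERBATIM (both disjuncts; we land in disjunct 2).
* §2 junction `example` — the :266 ∀-text with the three letters inserted after `hpos`, closed by §1: the shape of K2E3's eventual one-line body (JUNCTION RULE: one name per socket).
HONEST LABEL.  HC_CM is proved only modulo the 7 printed citations (2 remaining named inputs: hLiu418 = `stmt-HodgeConjecture-24832`, h413 = `stmt-HodgeConjecture-24833`) until rung 0
closes; this file is a head MODULO three letters — (S-W) stays the XL residual of :182 and is paid only when `HWA` ∕ `HWRa` ∕ `HWRb` are ★-discharged AND K2E3's edition is WRITTEN +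
BUILT; :182 ∕ A2′ OPEN; REL ≠ ★ ≠ BUILT; count-neutral; no printed citation is discharged.

## References
* [Keys1984] D. Keys, *Principal series representations of special unitary groups over local fields*, Compositio Math. 51 (1984), §5 Theorem (2) pp. 124–125, §7 Theorem (2) p. 126.
* [Rogawski1990] J. D. Rogawski, *Automorphic Representations of Unitary Groups in Three Variables*, Ann. of Math. Stud. 123 (1990), §12.2 (1)–(2) p. 173.
* [Shahidi1990] F. Shahidi, *A proof of Langlands' conjecture on Plancherel measures; complementary series for p-adic groups*, Ann. of Math. 132 (1990), §8.
* [Serre1979] J.-P. Serre, *Local Fields*, GTM 67 (1979), Ch. V §3 Prop. 5 Cor. 3.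
-/

set_option autoImplicit false
-- the mandated namespace has the single-problem summit's repeated segment (`HodgeConjecture.HodgeConjecture`)
set_option linter.dupNamespace false

noncomputable section

open NumberField IsDedekindDomain
open Literature.NumberTheory Literature.NumberTheory.Automorphic Literature.NumberTheory.Automorphic.UnitaryGroup
open Summit.HodgeConjecture.HodgeConjecture.Cruxes.H413

namespace Summit.HodgeConjecture.HodgeConjecture.R90.S1

variable (L : Type) [Field L] [NumberField L] [IsCMField L] (v : HeightOneSpectrum (𝓞 ↥(maximalRealSubfield L)))

/-! ## §1 The (S-W) head modulo `HWA` ∕ `HWRa` ∕ `HWRb` -/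

/-- **U4Keys :182 AT A WILDLY RAMIFIED NON-SPLIT PLACE, POSITIVE DEPTH, BOTH BRANCHES — THE (S-W) HEAD MODULO THREE NAMED LETTERS.**  `v` non-split (`hns`), ramified in `L` (`hunr`),
wild (`h2`: `|2|_{w′} ≠ 1` for some `w′`); `χ₁ : (L ⊗ L⁺_v)ˣ → ℂˣ` continuous (`h₁`), non-unitary (`hnu`), contracting (`hcontr`), ramified (`hram`), of positive depth (`hpos`); the
three cell letters `HWA` (Branch A ⟹ irreducible), `HWRa` (Branch B, (R-a) ⟹ irreducible), `HWRb` (Branch B, (R-b), reducible ⟹ the root `χ₁(σΠ·Π) = ‖σΠ·Π‖^{1∕2}` at some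
uniformiser unit `Π`); if `i(χ₁, 1)` is reducible (`hred`) then **`χ₁ = ‖·‖^{1∕2}·‖·‖^{1∕2} ∨ χ₁ = η·‖·‖^{1∕2}`** (the socket's conclusion; we reach disjunct 2).  Proof: `by_cases hB`
(Branch A: `absurd hred (HWA …)`); `by_cases hRa` ((R-a): `absurd hred (HWRa hB hRa)`); (R-b): ★ (W-2′) `exists_eta_of_branchB_of_exists_root_of_fixedUnit` with the root of `HWRb` and
the witness of `¬hRa`. [cite: Keys1984, §7 Theorem (2) p. 126] [cite: Rogawski1990, §12.2 (1)–(2) p. 173] [cite: Shahidi1990, §8] [cite: Serre1979, Ch. V §3 Prop. 5 Cor. 3] -/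
theorem exists_eta_of_reducible_posDepth_normTrivial_wild
    (hns : ∀ w' : PlacesOver L v, IsCMField.complexConj L • w'.1 = w'.1)
    (_hunr : ¬ Algebra.IsUnramifiedIn (𝓞 L) v.asIdeal)
    (_h2 : ¬ (∀ w' : PlacesOver L v, Valued.v (2 : w'.1.adicCompletion L) = 1))
    (χ₁ : (LocalRing L v)ˣ →* ℂˣ) (h₁ : Continuous fun x => ((χ₁ x : ℂˣ) : ℂ)) (_hnu : ∃ x, ‖((χ₁ x : ℂˣ) : ℂ)‖ ≠ 1)
    (_hcontr : ∀ x : (LocalRing L v)ˣ, unitModulusChar (LocalRing L v) x < 1 → ‖((χ₁ x : ℂˣ) : ℂ)‖ < 1)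
    (_hram : ¬ (∀ u ∈ (Submonoid.pi Set.univ (fun w : PlacesOver L v => (w.1.adicCompletionIntegers L).toSubring.toSubmonoid)).units, χ₁ u = 1))
    (_hpos : ∃ u : (LocalRing L v)ˣ, (∀ w' : PlacesOver L v, Valued.v (((u : LocalRing L v) w') - 1) < 1) ∧ χ₁ u ≠ 1)
    (HWA : (∃ u : (LocalRing L v)ˣ, (∀ w' : PlacesOver L v, Valued.v ((u : LocalRing L v) w') = 1) ∧
        χ₁ (u * Units.map (conjLocal L (IsCMField.complexConj L) v : LocalRing L v →* LocalRing L v) u) ≠ 1) →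
      ¬ (∃ N : Subrepresentation (cmPrincipalSeries L 3 v (cmTorusCharPair L v χ₁ 1)), N ≠ ⊥ ∧ N ≠ ⊤))
    (HWRa : (∀ u : (LocalRing L v)ˣ, (∀ w' : PlacesOver L v, Valued.v ((u : LocalRing L v) w') = 1) →
        χ₁ (u * Units.map (conjLocal L (IsCMField.complexConj L) v : LocalRing L v →* LocalRing L v) u) = 1) →
      (∀ a : (LocalRing L v)ˣ, Units.map (conjLocal L (IsCMField.complexConj L) v : LocalRing L v →* LocalRing L v) a = a →
        (∀ w' : PlacesOver L v, Valued.v ((a : LocalRing L v) w') = 1) → χ₁ a = 1) →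
      ¬ (∃ N : Subrepresentation (cmPrincipalSeries L 3 v (cmTorusCharPair L v χ₁ 1)), N ≠ ⊥ ∧ N ≠ ⊤))
    (HWRb : (∀ u : (LocalRing L v)ˣ, (∀ w' : PlacesOver L v, Valued.v ((u : LocalRing L v) w') = 1) →
        χ₁ (u * Units.map (conjLocal L (IsCMField.complexConj L) v : LocalRing L v →* LocalRing L v) u) = 1) →
      (∃ a : (LocalRing L v)ˣ, Units.map (conjLocal L (IsCMField.complexConj L) v : LocalRing L v →* LocalRing L v) a = a ∧
        (∀ w' : PlacesOver L v, Valued.v ((a : LocalRing L v) w') = 1) ∧ χ₁ a ≠ 1) →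
      (∃ N : Subrepresentation (cmPrincipalSeries L 3 v (cmTorusCharPair L v χ₁ 1)), N ≠ ⊥ ∧ N ≠ ⊤) →
      ∃ piU : (LocalRing L v)ˣ, (∀ w' : PlacesOver L v, Valued.v ((piU : LocalRing L v) w') = WithZero.exp (-1 : ℤ)) ∧
        χ₁ (Units.map (conjLocal L (IsCMField.complexConj L) v : LocalRing L v →* LocalRing L v) piU * piU) =
          halfModulusChar (LocalRing L v) (Units.map (conjLocal L (IsCMField.complexConj L) v : LocalRing L v →* LocalRing L v) piU * piU))
    (hred : ∃ N : Subrepresentation (cmPrincipalSeries L 3 v (cmTorusCharPair L v χ₁ 1)), N ≠ ⊥ ∧ N ≠ ⊤) :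
    χ₁ = halfModulusChar (LocalRing L v) * halfModulusChar (LocalRing L v) ∨
      (∃ η : (LocalRing L v)ˣ →* ℂˣ, IsQuadraticCharExtension (conjLocal L (IsCMField.complexConj L) v) η ∧
        Continuous (fun x => ((η x : ℂˣ) : ℂ)) ∧ χ₁ = η * halfModulusChar (LocalRing L v)) := by
  by_cases hB : ∀ u : (LocalRing L v)ˣ, (∀ w' : PlacesOver L v, Valued.v ((u : LocalRing L v) w') = 1) →
      χ₁ (u * Units.map (conjLocal L (IsCMField.complexConj L) v : LocalRing L v →* LocalRing L v) u) = 1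
  · -- BRANCH B: `by_cases` on the sub-branch (R-a) ∣ (R-b)
    by_cases hRa : ∀ a : (LocalRing L v)ˣ, Units.map (conjLocal L (IsCMField.complexConj L) v : LocalRing L v →* LocalRing L v) a = a →
        (∀ w' : PlacesOver L v, Valued.v ((a : LocalRing L v) w') = 1) → χ₁ a = 1
    · -- (R-a): irreducible by the letter `HWRa`
      exact absurd hred (HWRa hB hRa)
    · -- (R-b): the root (letter `HWRb`) + the uniformiser-free conversion ★ (W-2′) §4
      push Not at hRa
      obtain ⟨a, haσ, ha1, hχa⟩ := hRa
      obtain ⟨w⟩ := (inferInstance : Nonempty (PlacesOver L v))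
      exact Or.inr (BposRamConversionWild.exists_eta_of_branchB_of_exists_root_of_fixedUnit L v hns w (hns w) χ₁ h₁ hB
        (HWRb hB ⟨a, haσ, ha1, hχa⟩ hred) ⟨a, haσ, ha1, hχa⟩)
  · -- BRANCH A: irreducible by the letter `HWA`
    push Not at hB
    obtain ⟨u, hu, hA⟩ := hB
    exact absurd hred (HWA ⟨u, hu, hA⟩)

/-! ## §2 Junction with the (S-W) socket text -/

/-- JUNCTION (S-W): the ∀-text of `sig_K2E3KeysThmTwoContractingRamifiedCharOnePosDepthWild` (organ ED. 11 :266–:282, in the `LocalRing` spelling of ★ (8⁺b)) with the three letters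
`HWA HWRa HWRb` inserted after `hpos`, closed by §1 — the shape of K2E3's eventual one-line body once the three producers are ★ (JUNCTION RULE: one name per socket).
[cite: Keys1984, §7 Theorem (2) p. 126] [cite: Rogawski1990, §12.2 (1)–(2) p. 173] -/
example :
    ∀ (L : Type) [Field L] [NumberField L] [IsCMField L] (v : HeightOneSpectrum (𝓞 ↥(maximalRealSubfield L))),
      (∀ w : PlacesOver L v, IsCMField.complexConj L • w.1 = w.1) →
      ¬ Algebra.IsUnramifiedIn (𝓞 L) v.asIdeal →
      ¬ (∀ w' : PlacesOver L v, Valued.v (2 : w'.1.adicCompletion L) = 1) →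
      ∀ (χ₁ : (LocalRing L v)ˣ →* ℂˣ),
        Continuous (fun x => ((χ₁ x : ℂˣ) : ℂ)) → (∃ x, ‖((χ₁ x : ℂˣ) : ℂ)‖ ≠ 1) →
        (∀ x : (LocalRing L v)ˣ, unitModulusChar (LocalRing L v) x < 1 → ‖((χ₁ x : ℂˣ) : ℂ)‖ < 1) →
        ¬ (∀ u ∈ (Submonoid.pi Set.univ (fun w : PlacesOver L v => (w.1.adicCompletionIntegers L).toSubring.toSubmonoid)).units, χ₁ u = 1) →
        (∃ u : (LocalRing L v)ˣ, (∀ w' : PlacesOver L v, Valued.v (((u : LocalRing L v) w') - 1) < 1) ∧ χ₁ u ≠ 1) →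
        -- the three cell letters
        ((∃ u : (LocalRing L v)ˣ, (∀ w' : PlacesOver L v, Valued.v ((u : LocalRing L v) w') = 1) ∧
            χ₁ (u * Units.map (conjLocal L (IsCMField.complexConj L) v : LocalRing L v →* LocalRing L v) u) ≠ 1) →
          ¬ (∃ N : Subrepresentation (cmPrincipalSeries L 3 v (cmTorusCharPair L v χ₁ 1)), N ≠ ⊥ ∧ N ≠ ⊤)) →
        ((∀ u : (LocalRing L v)ˣ, (∀ w' : PlacesOver L v, Valued.v ((u : LocalRing L v) w') = 1) →
            χ₁ (u * Units.map (conjLocal L (IsCMField.complexConj L) v : LocalRing L v →* LocalRing L v) u) = 1) →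
          (∀ a : (LocalRing L v)ˣ, Units.map (conjLocal L (IsCMField.complexConj L) v : LocalRing L v →* LocalRing L v) a = a →
            (∀ w' : PlacesOver L v, Valued.v ((a : LocalRing L v) w') = 1) → χ₁ a = 1) →
          ¬ (∃ N : Subrepresentation (cmPrincipalSeries L 3 v (cmTorusCharPair L v χ₁ 1)), N ≠ ⊥ ∧ N ≠ ⊤)) →
        ((∀ u : (LocalRing L v)ˣ, (∀ w' : PlacesOver L v, Valued.v ((u : LocalRing L v) w') = 1) →
            χ₁ (u * Units.map (conjLocal L (IsCMField.complexConj L) v : LocalRing L v →* LocalRing L v) u) = 1) →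
          (∃ a : (LocalRing L v)ˣ, Units.map (conjLocal L (IsCMField.complexConj L) v : LocalRing L v →* LocalRing L v) a = a ∧
            (∀ w' : PlacesOver L v, Valued.v ((a : LocalRing L v) w') = 1) ∧ χ₁ a ≠ 1) →
          (∃ N : Subrepresentation (cmPrincipalSeries L 3 v (cmTorusCharPair L v χ₁ 1)), N ≠ ⊥ ∧ N ≠ ⊤) →
          ∃ piU : (LocalRing L v)ˣ, (∀ w' : PlacesOver L v, Valued.v ((piU : LocalRing L v) w') = WithZero.exp (-1 : ℤ)) ∧
            χ₁ (Units.map (conjLocal L (IsCMField.complexConj L) v : LocalRing L v →* LocalRing L v) piU * piU) =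
              halfModulusChar (LocalRing L v) (Units.map (conjLocal L (IsCMField.complexConj L) v : LocalRing L v →* LocalRing L v) piU * piU)) →
        (∃ N : Subrepresentation (cmPrincipalSeries L 3 v (cmTorusCharPair L v χ₁ 1)), N ≠ ⊥ ∧ N ≠ ⊤) →
        χ₁ = halfModulusChar (LocalRing L v) * halfModulusChar (LocalRing L v) ∨
        (∃ η : (LocalRing L v)ˣ →* ℂˣ, IsQuadraticCharExtension (conjLocal L (IsCMField.complexConj L) v) η ∧
          Continuous (fun x => ((η x : ℂˣ) : ℂ)) ∧ χ₁ = η * halfModulusChar (LocalRing L v)) :=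
  fun L _ _ _ v hns hunr h2 χ₁ h₁ hnu hcontr hram hpos HWA HWRa HWRb hred =>
    exists_eta_of_reducible_posDepth_normTrivial_wild L v hns hunr h2 χ₁ h₁ hnu hcontr hram hpos HWA HWRa HWRb hred

end Summit.HodgeConjecture.HodgeConjecture.R90.S1

end
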